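import Mathlib.Analysis.Complex.UpperHalfPlane.Manifold
import Mathlib.Analysis.Complex.UpperHalfPlane.FunctionsBoundedAtInfty
import Mathlib.Analysis.Complex.CauchyIntegral
import Mathlib.NumberTheory.ModularForms.Basic
import HarnessLib

/-!
# Horizontal periods of periodic holomorphic functions vanishing at `i∞` are zero

[[cite: Shintani1975, §2, proof of Prop. 2.3 (p. 103)]] — in the unfolding of Shintani's theta
lift the orbits of non-zero NULL lattice vectors (`(x, x) = 0`) have unipotent stabilisers, and
their contribution is a horizontal period `∫₀ʰ φ̃(u + iv) du` of a translate `φ̃ = φ|g` of the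
cusp form, which vanishes ("since `φ` is a cusp form, the above integral is zero", loc. cit.).
This file PROVES the underlying function-theoretic statement, for any `g : ℍ → ℂ`:

* `horizontalPeriod g h v = ∫₀ʰ g(u + iv) du`;
* `horizontalPeriod_eq` — for `g` holomorphic and `h`-periodic the period does not depend on
  `v > 0` (Cauchy's theorem on a rectangle, Mathlib
  `Complex.integral_boundary_rect_eq_zero_of_differentiableOn`; the vertical sides cancel);
* `tendsto_horizontalPeriod` — if `g → 0` at `i∞` (`IsZeroAtImInfty`, uniform in `Re`) then the
  period tends to `0`;
* **`horizontalPeriod_eq_zero`** — hence it vanishes identically.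

No named facts; the only definition is `horizontalPeriod`.
-/

noncomputable section

open scoped Manifold Topology
open UpperHalfPlane hiding I
open Complex Filter MeasureTheory Set intervalIntegral

namespace Literature.NumberTheory.EllipticCurves.ModularForms

/-- The horizontal period `P(v) = ∫₀ʰ g(u + iv) du` of a function on `ℍ`, through `ofComplex`. [folklore] -/
def horizontalPeriod (g : ℍ → ℂ) (h v : ℝ) : ℂ :=
  ∫ u in (0 : ℝ)..h, (g ∘ UpperHalfPlane.ofComplex) ((u : ℂ) + (v : ℂ) * Complex.I)

/-- For `v > 0` the integrand is `g` at the point `u + iv ∈ ℍ`. [folklore] -/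
theorem comp_ofComplex_of_im_pos (g : ℍ → ℂ) {z : ℂ} (hz : 0 < z.im) :
    (g ∘ UpperHalfPlane.ofComplex) z = g ⟨z, hz⟩ := by
  simp only [Function.comp_apply, ofComplex_apply_of_im_pos hz]

/-- **Independence of the height**: for `g` holomorphic on `ℍ` and `h`-periodic, `P(v₁) = P(v₂)`
(Cauchy's theorem on the rectangle `[0, h] × [v₁, v₂]`; the vertical sides cancel). [folklore] -/
theorem horizontalPeriod_eq (g : ℍ → ℂ) (hg : MDifferentiable 𝓘(ℂ) 𝓘(ℂ) g) {h : ℝ}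
    (hper : ∀ z : ℍ, g ((h : ℝ) +ᵥ z) = g z) {v₁ v₂ : ℝ} (hv₁ : 0 < v₁) (hv₂ : 0 < v₂) :
    horizontalPeriod g h v₁ = horizontalPeriod g h v₂ := by
  set G : ℂ → ℂ := g ∘ UpperHalfPlane.ofComplex with hG
  have hdiff : DifferentiableOn ℂ G {z : ℂ | 0 < z.im} := UpperHalfPlane.mdifferentiable_iff.mp hg
  -- Cauchy on the rectangle with corners `0 + i v₁` and `h + i v₂`
  set z : ℂ := ((0 : ℝ) : ℂ) + v₁ * Complex.I with hz
  set w : ℂ := (h : ℂ) + v₂ * Complex.I with hw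
  have hzre : z.re = (0 : ℝ) := by simp [hz]
  have hzim : z.im = v₁ := by simp [hz]
  have hwre : w.re = h := by simp [hw]
  have hwim : w.im = v₂ := by simp [hw]
  have hsub : (Set.uIcc z.re w.re ×ℂ Set.uIcc z.im w.im) ⊆ {z : ℂ | 0 < z.im} := by
    intro p hp
    rw [Complex.mem_reProdIm, hzim, hwim] at hp
    rcases Set.mem_uIcc.mp hp.2 with ⟨ha, _⟩ | ⟨ha, _⟩
    · exact lt_of_lt_of_le hv₁ ha
    · exact lt_of_lt_of_le hv₂ ha
  have hC := Complex.integral_boundary_rect_eq_zero_of_differentiableOn G z w (hdiff.mono hsub)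
  rw [hzre, hzim, hwre, hwim] at hC
  -- the vertical sides cancel by periodicity
  have hvert : (∫ y : ℝ in v₁..v₂, G ((h : ℂ) + y * Complex.I)) = ∫ y : ℝ in v₁..v₂, G ((0 : ℝ) + y * Complex.I) := by
    refine intervalIntegral.integral_congr fun y hy ↦ ?_
    have hy0 : 0 < y := by
      rcases Set.mem_uIcc.mp hy with ⟨ha, _⟩ | ⟨ha, _⟩
      · exact lt_of_lt_of_le hv₁ ha
      · exact lt_of_lt_of_le hv₂ ha
    have him1 : 0 < ((h : ℂ) + y * Complex.I).im := by simpa using hy0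
    have him2 : 0 < (((0 : ℝ) : ℂ) + y * Complex.I).im := by simpa using hy0
    simp only [hG]
    rw [comp_ofComplex_of_im_pos g him1, comp_ofComplex_of_im_pos g him2]
    have : (⟨(h : ℂ) + y * Complex.I, him1⟩ : ℍ) = ((h : ℝ) +ᵥ (⟨((0 : ℝ) : ℂ) + y * Complex.I, him2⟩ : ℍ)) := by
      apply UpperHalfPlane.ext
      simp [UpperHalfPlane.coe_vadd]
    rw [this, hper]
  simp only [horizontalPeriod]
  push_cast at hC ⊢
  rw [hvert] at hC
  -- `hC : (bottom - top) + I • (side - side) = 0`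
  have : (∫ x : ℝ in (0 : ℝ)..h, G (x + v₁ * Complex.I)) - ∫ x : ℝ in (0 : ℝ)..h, G (x + v₂ * Complex.I) = 0 := by
    simpa using hC
  exact sub_eq_zero.mp this

/-- **The period tends to `0` at `i∞`** when `g → 0` at `i∞` (uniformly in `Re`, as `atImInfty`
is). [folklore] -/
theorem tendsto_horizontalPeriod (g : ℍ → ℂ) {h : ℝ} (hh : 0 ≤ h)
    (h0 : IsZeroAtImInfty g) :
    Tendsto (fun v : ℝ ↦ horizontalPeriod g h v) atTop (𝓝 0) := by
  rw [Metric.tendsto_atTop]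
  intro ε hε
  rw [isZeroAtImInfty_iff] at h0
  obtain ⟨A, hA⟩ := h0 (ε / (h + 1)) (by positivity)
  refine ⟨max A 1, fun v hv ↦ ?_⟩
  have hv0 : 0 < v := lt_of_lt_of_le one_pos (le_trans (le_max_right _ _) hv)
  have hvA : A ≤ v := le_trans (le_max_left _ _) hv
  rw [dist_zero_right, horizontalPeriod]
  have hbound : ∀ u ∈ Set.uIoc (0 : ℝ) h, ‖(g ∘ UpperHalfPlane.ofComplex) ((u : ℂ) + (v : ℂ) * Complex.I)‖ ≤ ε / (h + 1) := by
    intro u _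
    have him : 0 < ((u : ℂ) + (v : ℂ) * Complex.I).im := by simpa using hv0
    rw [comp_ofComplex_of_im_pos g him]
    refine hA _ ?_
    show A ≤ UpperHalfPlane.im ⟨(u : ℂ) + (v : ℂ) * Complex.I, him⟩
    rw [UpperHalfPlane.im]
    simpa using hvA
  calc ‖∫ u in (0 : ℝ)..h, (g ∘ UpperHalfPlane.ofComplex) ((u : ℂ) + (v : ℂ) * Complex.I)‖
      ≤ ε / (h + 1) * |h - 0| := intervalIntegral.norm_integral_le_of_norm_le_const hbound
    _ < ε := by
        rw [sub_zero, abs_of_nonneg hh]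
        rw [div_mul_eq_mul_div, div_lt_iff₀ (by positivity)]
        nlinarith

/-- **Horizontal periods of cusp-type functions vanish**: for `g` holomorphic on `ℍ`, `h`-periodic
(`h ≥ 0`) and tending to `0` at `i∞`, `∫₀ʰ g(u + iv) du = 0` for every `v > 0` — the vanishing of
the constant term of a cusp form at a cusp, in integrated form. [folklore] -/
theorem horizontalPeriod_eq_zero (g : ℍ → ℂ) (hg : MDifferentiable 𝓘(ℂ) 𝓘(ℂ) g) {h : ℝ} (hh : 0 ≤ h)
    (hper : ∀ z : ℍ, g ((h : ℝ) +ᵥ z) = g z) (h0 : IsZeroAtImInfty g) {v : ℝ} (hv : 0 < v) :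
    horizontalPeriod g h v = 0 := by
  have hconst : ∀ v' : ℝ, 1 ≤ v' → horizontalPeriod g h v' = horizontalPeriod g h v := fun v' hv' ↦
    horizontalPeriod_eq g hg hper (lt_of_lt_of_le one_pos hv') hv
  have ht := tendsto_horizontalPeriod g hh h0
  have ht' : Tendsto (fun _ : ℝ ↦ horizontalPeriod g h v) atTop (𝓝 0) := by
    refine ht.congr' ?_
    rw [Filter.EventuallyEq, Filter.eventually_atTop]
    exact ⟨1, fun v' hv' ↦ hconst v' hv'⟩
  exact tendsto_nhds_unique tendsto_const_nhds ht'

end Literature.NumberTheory.EllipticCurves.ModularForms
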